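/-
Copyright (c) 2026 the pub-hodgecm-mathlib formalisation cell (harness21).  Prover seat hodgecm-mathlib-LH4-p14 (g2), req620 Track A «(D-RAM) FOUR-FRAME» squad
(unit U3_Laws, MS ROAD A Stage A; brick (O2b) «fibre count along a unit-torus orbit» of LH4-p11 (g0)'s cut 23:33:55Z, lattice half — transport, the one-coset fibre at type 0,
norm classes; MS first seat LH4-p11 (g0), Stage B lead LH4-p10 (g2), dealer LH4-plan (g11)).  2026-09-04.
-/
import Summits.HodgeConjecture.HodgeConjecture.Theorems.F0P3cDyRamDiagonalTorusDefs            -- ★ DEFS LEAF p855572: `diagGLUnits`, `unitTorus`, `fixedUnitTorus`, `unitNormMap`, stabilisers, `IsNormalisedLattice`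
import Summits.HodgeConjecture.HodgeConjecture.Theorems.F0P3cDyRamDiagonalVertexTranslate       -- ★ K p855415: `isVertexLattice_diagonal_mapGL_diagonal`
import Summits.HodgeConjecture.HodgeConjecture.Theorems.F0P3cDyRamDiagonalSelfDualFibre         -- ★ (3b) p855307: `mapGL_diagonal_div_eq_of_isVertexLattice_zero_diagonal`, `isVertexLattice_zero_diagonal_mul_of_mapGL_diagonal_eq`
import Summits.HodgeConjecture.HodgeConjecture.Theorems.F0P3cDyRamDiagonalNormalisedOrbit        -- ★ J′ p855450: `forall_normalisedAt_mapGL_diagonal_latt_iff`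
import Summits.HodgeConjecture.HodgeConjecture.Theorems.F0P3cDyRamUnitTripleNormIndexEight      -- ★ M p855457: `exists_normClass_of_dichotomy`, `existsUnique_signVector_of_dichotomy`
import Literature.NumberTheory.Automorphic.UnitaryLatticeTreeTypeTwoHyperbolic                     -- ★ `eq_one_of_mul_self_eq_one` (in `ℤᵐ⁰`)
import HarnessLib

/-!
# Crux `H413`, line LH4 «(D-RAM) FOUR-FRAME» road — unit U3_Laws (iii), MS ROAD A, brick (O2b) PART 2: TRANSPORT OF THE FIBRE ALONG `diag`, THE ONE-COSET FIBRE AT TYPE 0,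
# AND THE NORM CLASSES OF THE `σ`-FIXED UNIT TORUS

Cell `hodgecm-mathlib` (D-0151), FLOOR 0, crux item H413 = `stmt-HodgeConjecture-24833`, route of record `HCCMUnconditional`; squad F0∕P3c∕LH4 (req618∕req620).  THEOREMS ONLY
(no `def`, no instance, no notation, no `sorry`); lane `--supports stmt-HodgeConjecture-24833 --as helper` (count-neutral).  The lattice-side inputs of the (O2b) count
(LH4-p11 (g0) cut 2026-09-03T23:33:55Z; route LH4-p10 MEMO-stableLaw-finite v1 §2 (3)(b)(c)(d)):
* §1 `ncard_subgroup_orbit_eq_relIndex` ∕ `ncard_translate_subgroup_orbit_eq_relIndex` — orbit–stabiliser for ANY subgroup `H ≤ (K^×)^N` acting by `diag` (★ (O1)'s `letI`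
  technique verbatim): `#{diag(u₀h)·M₀ : h ∈ H} = [H : latticeStabilizer M₀ ⊓ H]`;
* §2 `isVertexLattice_diagonal_mapGL_diagGLUnits_iff` — ★ K both ways: `diag(z)·M` is a type-`t` vertex of `diag(D)` iff `M` is one of `diag(D·N(z))`, `N(z)_i = z_iσ(z_i)`;
* §3 norm-map bookkeeping (`unitNormMap`): values, `σ`-invariance under an involution, units go to `fixedUnitTorus`, membership in `N(𝒯)`;
* §4 `existsUnique_signVector_mem_map_unitNormMap` — ★ M in subgroup currency: the `c^e` (`e : Fin N → Bool`) are a system of representatives of `𝒰 ∕ N(𝒯)`;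
  `exists_zpow_fixedUnit_decomposition` — every `σ`-fixed non-zero vector is `N(ϖu^{a})·w` with `w ∈ 𝒰` (even valuations from the dichotomy);
* §5 `fibre_isCoset_zero` — THE TYPE-0 FIBRE IS ONE `S_F`-COSET (★ (3b) + ★ J′): for a normalised `M₀ = latt g` with a `σ`-fixed type-0 form `diag(D₁)`, a `σ`-fixed non-degenerate
  `diag(D)` has `M₀` as a type-0 vertex iff `D = D₁·u` for some `u ∈ fixedUnitStabilizer σ M₀` — the hypothesis `hcoset` of PART 3 at `tv = 0` (at `tv = 2` it is LH4-p10's B9-0).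
HONEST LABEL.  Count-neutral (`--supports`); nothing printed is asserted; (MS) stays a PROVER TARGET; `HC_CM` is proved only modulo the 7 printed citations (2 remaining named inputs:
hLiu418 = `stmt-HodgeConjecture-24832`, h413 = `stmt-HodgeConjecture-24833`) until rung 0 closes.

## References
* [Kottwitz1986BaseChangeUnits] R. E. Kottwitz, *Base change for unit elements of Hecke algebras*, Compositio Math. 60 (1986), §1 pp. 240–241.
* [Serre1979] J.-P. Serre, *Local Fields*, GTM 67 (1979), Ch. V §3.
* [Serre1980Trees] J.-P. Serre, *Trees*, Springer (1980), Ch. II §1.1.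
* [Jacobowitz1962] R. Jacobowitz, *Hermitian forms over local fields*, Amer. J. Math. 84 (1962), §7.
-/

set_option autoImplicit false

noncomputable section

namespace Summit.HodgeConjecture.HodgeConjecture.Cruxes.H413.F0P3cDyRamDiagonalOrbitFibreTransport

open Matrix
open Literature.NumberTheory.Automorphic Literature.NumberTheory.Automorphic.HermitianLattice
open Literature.NumberTheory.Automorphic.UnitaryLatticeTree
open Summit.HodgeConjecture.HodgeConjecture.Cruxes.H413.F0P3cDyRamDiagonalTorusDefs
open Summit.HodgeConjecture.HodgeConjecture.Cruxes.H413.F0P3cDyRamDiagonalVertexTranslate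
open Summit.HodgeConjecture.HodgeConjecture.Cruxes.H413.F0P3cDyRamDiagonalSelfDualFibre
open Summit.HodgeConjecture.HodgeConjecture.Cruxes.H413.F0P3cDyRamDiagonalNormalisedOrbit
open Summit.HodgeConjecture.HodgeConjecture.Cruxes.H413.F0P3cDyRamUnitTripleNormIndexEight
open scoped Valued WithZero Matrix MatrixGroups

variable {K : Type*} [Field K] [Valued K ℤᵐ⁰] {N : ℕ}

/-! ## §1  Orbit–stabiliser for an arbitrary subgroup of `(K^×)^N` acting by `diag` -/

/-- **`#(H · M₀) = [H : latticeStabilizer M₀ ⊓ H]`** for every subgroup `H ≤ (K^×)^N` and every `𝒪`-submodule `M₀` (both sides `0` iff infinite) — ★ (O1) `ncard_unitTorus_orbit_eq_relIndex`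
with `unitTorus` replaced by `H`, same proof. [cite: Kottwitz1986BaseChangeUnits, §1 pp. 240–241] [cite: Serre1980Trees, II §1.1] -/
theorem ncard_subgroup_orbit_eq_relIndex (H : Subgroup (Fin N → Kˣ)) (M₀ : Submodule 𝒪[K] (Fin N → K)) :
    {M : Submodule 𝒪[K] (Fin N → K) | ∃ u ∈ H, M = mapGL (diagGLUnits u) M₀}.ncard = (latticeStabilizer M₀).relIndex H := by
  classical
  letI : MulAction (Fin N → Kˣ) (Submodule 𝒪[K] (Fin N → K)) :=
    { smul := fun z M => mapGL (diagGLUnits z) M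
      one_smul := fun M => by
        change mapGL (diagGLUnits (1 : Fin N → Kˣ)) M = M
        rw [map_one, mapGL_one]
      mul_smul := fun z w M => by
        change mapGL (diagGLUnits (z * w)) M = mapGL (diagGLUnits z) (mapGL (diagGLUnits w) M)
        rw [map_mul, mapGL_mul] }
  have horbit : MulAction.orbit H M₀ = {M : Submodule 𝒪[K] (Fin N → K) | ∃ u ∈ H, M = mapGL (diagGLUnits u) M₀} := by
    ext M
    simp only [MulAction.mem_orbit_iff, Set.mem_setOf_eq]
    constructor
    · rintro ⟨⟨u, hu⟩, rfl⟩
      exact ⟨u, hu, rfl⟩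
    · rintro ⟨u, hu, rfl⟩
      exact ⟨⟨u, hu⟩, rfl⟩
  have hstab : MulAction.stabilizer H M₀ = (latticeStabilizer M₀).subgroupOf H := by
    ext u
    rw [MulAction.mem_stabilizer_iff, Subgroup.mem_subgroupOf, mem_latticeStabilizer_iff]
    rfl
  rw [Subgroup.relIndex, ← hstab, MulAction.index_stabilizer, horbit]

/-- `mapGL g` is injective on submodules. [cite: Serre1980Trees, II §1.1] -/
theorem mapGL_injective (g : GL (Fin N) K) : Function.Injective (mapGL g : Submodule 𝒪[K] (Fin N → K) → Submodule 𝒪[K] (Fin N → K)) := by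
  intro M M' h
  have := congrArg (mapGL g⁻¹) h
  rwa [mapGL_inv_mapGL, mapGL_inv_mapGL] at this

/-- **A TRANSLATE OF AN `H`-ORBIT HAS THE SAME SIZE**: `#{diag(u₀·h)·M₀ : h ∈ H} = [H : latticeStabilizer M₀ ⊓ H]`. [cite: Kottwitz1986BaseChangeUnits, §1 pp. 240–241] -/
theorem ncard_translate_subgroup_orbit_eq_relIndex (H : Subgroup (Fin N → Kˣ)) (u₀ : Fin N → Kˣ) (M₀ : Submodule 𝒪[K] (Fin N → K)) :
    {M : Submodule 𝒪[K] (Fin N → K) | ∃ u ∈ H, M = mapGL (diagGLUnits (u₀ * u)) M₀}.ncard = (latticeStabilizer M₀).relIndex H := by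
  have hset : {M : Submodule 𝒪[K] (Fin N → K) | ∃ u ∈ H, M = mapGL (diagGLUnits (u₀ * u)) M₀}
      = mapGL (diagGLUnits u₀) '' {M : Submodule 𝒪[K] (Fin N → K) | ∃ u ∈ H, M = mapGL (diagGLUnits u) M₀} := by
    ext M
    simp only [Set.mem_setOf_eq, Set.mem_image]
    constructor
    · rintro ⟨u, hu, rfl⟩
      exact ⟨_, ⟨u, hu, rfl⟩, by rw [map_mul, mapGL_mul]⟩
    · rintro ⟨_, ⟨u, hu, rfl⟩, rfl⟩
      exact ⟨u, hu, by rw [map_mul, mapGL_mul]⟩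
  rw [hset, Set.ncard_image_of_injective _ (mapGL_injective _), ncard_subgroup_orbit_eq_relIndex]

/-! ## §2  Transport of the vertex property along `diag(z)` -/

/-- **`diag(z)·M` IS A TYPE-`t` VERTEX OF `diag(D)` IFF `M` IS ONE OF `diag(D·N(z))`** (`N(z)_i = z_i·σ(z_i)`; ★ K `isVertexLattice_diagonal_mapGL_diagonal` applied to `z` and to
`z⁻¹`). [cite: Jacobowitz1962, §7] [cite: Serre1980Trees, II §1.1] -/
theorem isVertexLattice_diagonal_mapGL_diagGLUnits_iff (σ : K →+* K) (ϖ : K) (D : Fin N → K) (z : Fin N → Kˣ) (t : ℕ) (M : Submodule 𝒪[K] (Fin N → K)) :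
    IsVertexLattice σ ϖ (Matrix.diagonal D) t (mapGL (diagGLUnits z) M) ↔
      IsVertexLattice σ ϖ (Matrix.diagonal fun i => D i * ((z i : K) * σ (z i))) t M := by
  have hz : ∀ i, ((z i : Kˣ) : K) ≠ 0 := fun i => (z i).ne_zero
  have hzi : ∀ i, (((z⁻¹) i : Kˣ) : K) ≠ 0 := fun i => ((z⁻¹) i).ne_zero
  constructor
  · intro h
    have h' := isVertexLattice_diagonal_mapGL_diagonal σ ϖ D (fun i => (((z⁻¹) i : Kˣ) : K)) hzi (diagGLUnits z⁻¹) (coe_diagGLUnits z⁻¹) h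
    rw [← mapGL_mul, ← map_mul, inv_mul_cancel, map_one, mapGL_one] at h'
    convert h' using 3
    rw [Pi.inv_apply, Units.val_inv_eq_inv_val, map_inv₀, ← mul_inv, inv_inv]
  · intro h
    have h' := isVertexLattice_diagonal_mapGL_diagonal σ ϖ (fun i => D i * ((z i : K) * σ (z i))) (fun i => ((z i : Kˣ) : K)) hz
      (diagGLUnits z) (coe_diagGLUnits z) h
    convert h' using 3
    exact (mul_inv_cancel_right₀ (mul_ne_zero (hz _) ((map_ne_zero σ).2 (hz _))) _).symm

/-! ## §3  Norm-map bookkeeping -/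

omit [Valued K ℤᵐ⁰] in
/-- `N(z)` is `σ`-fixed when `σ` is an involution. [cite: Serre1979, Ch. V §3] -/
theorem map_unitNormMap_apply {σ : K →+* K} (hσ : ∀ x, σ (σ x) = x) (z : Fin N → Kˣ) (i : Fin N) :
    σ ((unitNormMap σ N z i : Kˣ) : K) = unitNormMap σ N z i := by
  rw [unitNormMap_apply, map_mul, hσ, mul_comm]

/-- `N` maps the unit torus into the `σ`-fixed unit torus (`σ` an isometric involution). [cite: Serre1979, Ch. V §3] -/
theorem unitNormMap_mem_fixedUnitTorus {σ : K →+* K} (hσ : ∀ x, σ (σ x) = x) (hvσ : ∀ a, Valued.v (σ a) = Valued.v a)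
    {z : Fin N → Kˣ} (hz : z ∈ unitTorus K N) : unitNormMap σ N z ∈ fixedUnitTorus σ N := by
  rw [mem_fixedUnitTorus_iff]
  refine ⟨fun i => ?_, fun i => map_unitNormMap_apply hσ z i⟩
  rw [unitNormMap_apply, map_mul, hvσ, (mem_unitTorus_iff z).1 hz i, mul_one]

/-- `N(𝒯) ≤ 𝒰`. [cite: Serre1979, Ch. V §3] -/
theorem map_unitNormMap_unitTorus_le {σ : K →+* K} (hσ : ∀ x, σ (σ x) = x) (hvσ : ∀ a, Valued.v (σ a) = Valued.v a) :
    (unitTorus K N).map (unitNormMap σ N) ≤ fixedUnitTorus σ N := by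
  rintro _ ⟨z, hz, rfl⟩
  exact unitNormMap_mem_fixedUnitTorus hσ hvσ hz

/-- **MEMBERSHIP IN `N(𝒯)`**: a vector `y` lies in `N(𝒯)` iff it is slotwise a norm `z_i·σ(z_i)` of units; with `σ` isometric it suffices that `y_i = z_iσ(z_i)` for SOME `z_i ∈ K`
and `|y_i| = 1`. [cite: Serre1979, Ch. V §3] -/
theorem mem_map_unitNormMap_of_eq_norm {σ : K →+* K} (hvσ : ∀ a, Valued.v (σ a) = Valued.v a) {y : Fin N → Kˣ}
    (hy : ∀ i, Valued.v (y i : K) = 1) (z : Fin N → K) (hz : ∀ i, (y i : K) = z i * σ (z i)) :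
    y ∈ (unitTorus K N).map (unitNormMap σ N) := by
  have hz0 : ∀ i, z i ≠ 0 := fun i h0 => (y i).ne_zero (by rw [hz i, h0, zero_mul])
  refine ⟨fun i => Units.mk0 (z i) (hz0 i), ?_, ?_⟩
  · show (fun i => Units.mk0 (z i) (hz0 i)) ∈ unitTorus K N
    rw [mem_unitTorus_iff]
    intro i
    have h1 : Valued.v (z i) * Valued.v (z i) = 1 := by
      have := hy i
      rw [hz i, map_mul, hvσ] at this
      exact this
    exact eq_one_of_mul_self_eq_one h1
  · funext i
    exact Units.ext (by rw [unitNormMap_apply, Units.val_mk0, ← hz i])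

/-! ## §4  Norm classes: the `c^e` represent `𝒰 ∕ N(𝒯)`; even valuations -/

/-- **THE `c^e` ARE A SYSTEM OF REPRESENTATIVES OF `𝒰 ∕ N(𝒯)`** (★ M in subgroup currency): under (NI2) with a NON-NORM `σ`-fixed unit witness `c`, every `x ∈ 𝒰` has a UNIQUE
sign vector `e : Fin N → Bool` with `x·(c^e)⁻¹ ∈ N(𝒯)` (`(c^e)_i = c` if `e i` else `1`). [cite: Serre1979, Ch. V §3] -/
theorem existsUnique_signVector_mem_map_unitNormMap {σ : K →+* K} (hvσ : ∀ a, Valued.v (σ a) = Valued.v a)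
    {c : K} (hσc : σ c = c) (hcv : Valued.v c = 1) (hc : ¬ ∃ z : K, z * σ z = c)
    (hdich : ∀ x : K, σ x = x → x ≠ 0 → (∃ z : K, z * σ z = x) ∨ ∃ z : K, z * σ z = c * x)
    (cU : Kˣ) (hcU : (cU : K) = c) (x : Fin N → Kˣ) (hx : x ∈ fixedUnitTorus σ N) :
    ∃! e : Fin N → Bool, x * (fun i => if e i then cU else 1)⁻¹ ∈ (unitTorus K N).map (unitNormMap σ N) := by
  have hc0 : c ≠ 0 := fun h => by simp [h] at hcv
  rw [mem_fixedUnitTorus_iff] at hx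
  obtain ⟨e, ⟨z, hz⟩, huniq⟩ := existsUnique_signVector_of_dichotomy σ hσc hcv hc hdich (fun i => (x i : K)) (fun i => ⟨hx.2 i, hx.1 i⟩)
  have hval : ∀ (e' : Fin N → Bool) (i : Fin N), (((fun i => if e' i then cU else 1) : Fin N → Kˣ) i : K) = if e' i then c else 1 := by
    intro e' i
    by_cases h : e' i <;> simp [h, hcU]
  refine ⟨e, ?_, fun e' he' => ?_⟩
  · refine mem_map_unitNormMap_of_eq_norm hvσ (fun i => ?_) z (fun i => ?_)
    · rw [Pi.mul_apply, Pi.inv_apply, Units.val_mul, Units.val_inv_eq_inv_val, map_mul, map_inv₀, hval, hx.1 i]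
      by_cases h : e i <;> simp [h, hcv]
    · rw [Pi.mul_apply, Pi.inv_apply, Units.val_mul, Units.val_inv_eq_inv_val, hval, hz i]
      have hne : (if e i then c else (1 : K)) ≠ 0 := by by_cases h : e i <;> simp [h, hc0]
      field_simp
  · obtain ⟨t, ht, hteq⟩ := he'
    apply huniq e'
    refine ⟨fun i => (t i : K), fun i => ?_⟩
    have h1 := congrArg (fun f : Fin N → Kˣ => ((f i : Kˣ) : K)) hteq
    simp only [unitNormMap_apply, Pi.mul_apply, Pi.inv_apply, Units.val_mul, Units.val_inv_eq_inv_val, hval] at h1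
    have hne : (if e' i then c else (1 : K)) ≠ 0 := by by_cases h : e' i <;> simp [h, hc0]
    rw [h1]
    field_simp

/-- **EVEN VALUATIONS ∕ THE `N(ϖu^{a})·w` DECOMPOSITION**: under the dichotomy, every `σ`-fixed non-zero vector `D` is `D_i = N(ϖu)_i^{a_i} · w_i` with `a : Fin N → ℤ` and `w ∈ 𝒰`
(`ϖu` a uniformiser as a unit, `|ϖ| = exp(−1)`, `σ` an isometric involution) — precisely `D_i = ((ϖu^{a_i})·σ(ϖu^{a_i}))·w_i`. [cite: Serre1979, Ch. V §3] -/
theorem exists_zpow_fixedUnit_decomposition {σ : K →+* K} (hσ : ∀ x, σ (σ x) = x) (hvσ : ∀ a, Valued.v (σ a) = Valued.v a)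
    {ϖ : K} (hϖ : Valued.v ϖ = WithZero.exp (-1 : ℤ)) (ϖu : Kˣ) (hϖu : (ϖu : K) = ϖ)
    {c : K} (hσc : σ c = c) (hcv : Valued.v c = 1)
    (hdich : ∀ x : K, σ x = x → x ≠ 0 → (∃ z : K, z * σ z = x) ∨ ∃ z : K, z * σ z = c * x)
    (D : Fin N → K) (hD : ∀ i, σ (D i) = D i ∧ D i ≠ 0) :
    ∃ (a : Fin N → ℤ) (w : Fin N → Kˣ), w ∈ fixedUnitTorus σ N ∧
      ∀ i, D i = (unitNormMap σ N (fun j => ϖu ^ a j) i : Kˣ) * (w i : Kˣ) := by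
  have hc0 : c ≠ 0 := fun h => by simp [h] at hcv
  -- slotwise: `D i = c^{ε} · z σ z`, `|z| = exp(n)`
  have key : ∀ i, ∃ (n : ℤ) (wi : Kˣ), Valued.v (wi : K) = 1 ∧ σ (wi : K) = wi ∧
      D i = (((ϖu ^ (-n) : Kˣ) : K) * σ (((ϖu ^ (-n) : Kˣ) : K))) * wi := by
    intro i
    obtain ⟨ε, z, hz⟩ := exists_normClass_of_dichotomy σ hσc hc0 hdich (hD i).1 (hD i).2
    have hz0 : z ≠ 0 := fun h0 => (hD i).2 (by rw [hz, h0, zero_mul, mul_zero])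
    have hvz0 : Valued.v z ≠ 0 := (Valuation.ne_zero_iff _).2 hz0
    set n : ℤ := WithZero.log (Valued.v z) with hn
    have hvz : Valued.v z = WithZero.exp n := by rw [hn, WithZero.exp_log hvz0]
    -- `t := z · ϖ^{n}` is a unit
    have hϖ0 : (ϖu : K) ≠ 0 := ϖu.ne_zero
    have hvt : Valued.v (z * ((ϖu ^ n : Kˣ) : K)) = 1 := by
      rw [map_mul, Units.val_zpow_eq_zpow_val, map_zpow₀, hϖu, hϖ, hvz, ← WithZero.exp_zsmul, ← WithZero.exp_add]
      simp
    have hεu : Valued.v (if ε then c else (1 : K)) = 1 := by by_cases h : ε <;> simp [h, hcv]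
    have hε0 : (if ε then c else (1 : K)) ≠ 0 := by by_cases h : ε <;> simp [h, hc0]
    have hεσ : σ (if ε then c else (1 : K)) = (if ε then c else 1) := by by_cases h : ε <;> simp [h, hσc]
    set t : K := z * ((ϖu ^ n : Kˣ) : K) with ht
    have ht0 : t ≠ 0 := fun h0 => by rw [h0, map_zero] at hvt; exact zero_ne_one hvt
    refine ⟨n, Units.mk0 ((if ε then c else 1) * (t * σ t)) (mul_ne_zero hε0 (mul_ne_zero ht0 ((map_ne_zero σ).2 ht0))), ?_, ?_, ?_⟩
    · rw [Units.val_mk0, map_mul, map_mul, hvσ, hεu, hvt, one_mul, one_mul]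
    · rw [Units.val_mk0, map_mul, map_mul, hεσ, hσ, mul_comm (σ t) t]
    · rw [Units.val_mk0, hz, ht, Units.val_zpow_eq_zpow_val, Units.val_zpow_eq_zpow_val, map_mul, map_zpow₀, map_zpow₀, _root_.zpow_neg, _root_.zpow_neg]
      field_simp
  choose n w hw1 hw2 hw3 using key
  refine ⟨fun i => -n i, w, (mem_fixedUnitTorus_iff σ w).2 ⟨hw1, hw2⟩, fun i => ?_⟩
  rw [unitNormMap_apply]
  exact hw3 i

/-! ## §5  The type-0 fibre is one `S_F`-coset -/

/-- **THE TYPE-0 FIBRE OVER A NORMALISED LATTICE IS ONE `S_F(M₀)`-COSET** (the `hcoset` input of PART 3 at `tv = 0`).  For a normalised `M₀ = latt g` and a `σ`-fixed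
non-degenerate `diag(D₁)` for which `M₀` is a type-0 (self-dual) vertex: a `σ`-fixed non-degenerate `diag(D)` has `M₀` as a type-0 vertex iff `D = D₁·u` with
`u ∈ fixedUnitStabilizer σ M₀` — (→) ★ (3b)(i) `diag(D∕D₁)` stabilises `M₀`, it is `σ`-fixed, and its entries are units because `diag(D∕D₁)·M₀ = M₀` is normalised (★ J′);
(←) ★ (3b)(ii). [cite: Jacobowitz1962, §7] [cite: Kottwitz1986BaseChangeUnits, §1 pp. 240–241] -/
theorem fibre_isCoset_zero {σ : K →+* K} (hvσ : ∀ a, Valued.v (σ a) = Valued.v a) (ϖ : K) (g : GL (Fin 3) K)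
    {M₀ : Submodule 𝒪[K] (Fin 3 → K)} (hM₀ : M₀ = latt (g : Matrix (Fin 3) (Fin 3) K)) (hnorm : IsNormalisedLattice M₀)
    (D₁ : Fin 3 → K) (hD₁ : ∀ i, σ (D₁ i) = D₁ i ∧ D₁ i ≠ 0) (hV₁ : IsVertexLattice σ ϖ (Matrix.diagonal D₁) 0 M₀)
    (D : Fin 3 → K) (hD : ∀ i, σ (D i) = D i ∧ D i ≠ 0) :
    IsVertexLattice σ ϖ (Matrix.diagonal D) 0 M₀ ↔ ∃ u ∈ fixedUnitStabilizer σ M₀, ∀ i, D i = D₁ i * (u i : Kˣ) := by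
  constructor
  · intro hV
    obtain ⟨u, hu⟩ : ∃ u : Fin 3 → Kˣ, ∀ i, (u i : K) = D i / D₁ i :=
      ⟨fun i => Units.mk0 (D i / D₁ i) (div_ne_zero (hD i).2 (hD₁ i).2), fun _ => rfl⟩
    have hcoe : ((diagGLUnits u : GL (Fin 3) K) : Matrix (Fin 3) (Fin 3) K) = Matrix.diagonal fun i => D i / D₁ i := by
      rw [coe_diagGLUnits]; congr 1; funext i; exact hu i
    have hstab : mapGL (diagGLUnits u) M₀ = M₀ :=
      mapGL_diagonal_div_eq_of_isVertexLattice_zero_diagonal hvσ (fun i => (hD i).2) (fun i => (hD₁ i).2) hV hV₁ (diagGLUnits u) hcoe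
    refine ⟨u, ?_, fun i => ?_⟩
    · rw [mem_fixedUnitStabilizer_iff]
      refine ⟨hstab, ?_, fun i => ?_⟩
      · have hn : ∀ i, (∀ x ∈ mapGL (diagGLUnits u) (latt (g : Matrix (Fin 3) (Fin 3) K)), Valued.v (x i) ≤ 1) ∧
            ∃ x ∈ mapGL (diagGLUnits u) (latt (g : Matrix (Fin 3) (Fin 3) K)), Valued.v (x i) = 1 := by
          rw [← hM₀, hstab]; exact hnorm
        exact (forall_normalisedAt_mapGL_diagonal_latt_iff g (fun i => (u i : K)) (diagGLUnits u) (coe_diagGLUnits u) (hM₀ ▸ hnorm)).1 hn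
      · rw [hu i, map_div₀, (hD i).1, (hD₁ i).1]
    · rw [hu i, mul_div_cancel₀ _ (hD₁ i).2]
  · rintro ⟨u, hu, hDu⟩
    rw [mem_fixedUnitStabilizer_iff] at hu
    have h := isVertexLattice_zero_diagonal_mul_of_mapGL_diagonal_eq hV₁ (diagGLUnits u) (coe_diagGLUnits u) hu.1
    have hfun : (fun i => D₁ i * (u i : K)) = D := funext fun i => (hDu i).symm
    rwa [hfun] at h

end Summit.HodgeConjecture.HodgeConjecture.Cruxes.H413.F0P3cDyRamDiagonalOrbitFibreTransport

end
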